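/-
COR-CM (cell pub-hodgecm2, stage 2 of the Hodge ladder) — count-neutral KERNEL COMBINATORICS «the index-two cyclic law» (modular ∪ semidihedral
columns), part I: the datum `(G ⊃ ⟨u⟩ ∋ c = uⁿ, w)` of a cyclic subgroup of index two split by an involution (seat prover-pub-hodgecm2-b23-g49-0,
binder prover b23, gen 49; claim «INDEX-TWO CYCLIC LAW», HOME/INBOX.md l.22678).  One structure (`Datum`) + theorems, on top of seat b09ʼs
intrinsic model (`CMF G c`, `rt`, `oflipCM`, `orb`: `CorCM/Prior/AllgGroup1.lean`, `Census/BlockParityLaw.lean`); the arc lemmas of `ℤ/2n`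
of seat b23 gen 48 (`Dihedral.val_add_n`, `Dihedral.inArc_add_n`, …: `Census/DihedralDatum.lean`) are used BY NAME in the later parts; no `decide`,
no certificate, no named fact, no `sorry`; `Interfaces.lean` (C1), every E term, B01, `Transposition/*`, `PortJoin/*`, `D2Bridge/*` untouched.
HONEST FRAMING: `HC_CM` is NOT proved, here or anywhere in the tree; nothing here is a period, a count of record or a headline.
T5: n/a-class (hypothesis binders are the fields of `Datum`: `uⁿ = c`, `orderOf u = 2n`, `[⟨u⟩ : G] = 2`, `w ∉ ⟨u⟩`, `w·w = 1`, `w·u = uʳ·w`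
— inhabited by the dihedral (`r = 2n − 1`), modular (`r = n + 1`), semidihedral (`r = n − 1`) groups and by `ℤ/2n × ℤ/2` (`r = 1`); checker: self).
-/
import Summits.HodgeConjecture.CorCM.Census.DihedralDatum

/-!
# The index-two cyclic law, I: the datum of a cyclic subgroup of index two split by an involution

THE SETTING.  `G` a finite group, `u ∈ G` of order `2n` generating a subgroup of index two, `c = uⁿ` (a central involution), and an INVOLUTION
`w` outside `⟨u⟩` with `w·u = uʳ·w` (`Datum`): `G ≅ ℤ/2n ⋊_r ℤ/2` is the split extension of the cyclic group `ℤ/2n` by an involution acting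
as multiplication by `r` (`r² ≡ 1 (mod 2n)` is forced, `r_mul_r`).  The four columns of 2-power order are the abelian group `ℤ/2n × ℤ/2`
(`r = 1`), the dihedral group `D_{2n}` (`r = 2n − 1`, seat b23 gen 48ʼs `Dihedral.Datum`), the MODULAR group `M_{4n}` (`r = n + 1`) and the
SEMIDIHEDRAL group `SD_{4n}` (`r = n − 1`); for composite `n` every `r` with `r² ≡ 1` occurs (`G(24,5)`, `M₁₆ × ℤ/3 = G(24,13)`, …).
Every element is a rotation `uⁱ` or a coset element `uⁱ·w` (`exists_pow_or_pow_mul_w`), `w·uⁱ = u^{ri}·w`.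

An abstract CM type `Ψ : CMF G c` is read through two CM types of the cyclic group `ℤ/2n`: its ROTATION PART `{i ∣ uⁱ ∈ Ψ}` and its COSET PART
`{i ∣ uⁱ·w ∈ Ψ}` (= the rotation part of the base change `Ψ·w`).  The base change along `uᵏ` translates the rotation part by `−k` and the
coset part by `−rk`; the base change along `w` SWAPS them.

* §1 the datum: `w⁻¹ = w`, `w·uⁱ = u^{ri}·w`, `r` is odd and `r² ≡ 1`, `u^{rn} = uⁿ = c`, `c` commutes with everything (`comm_pow_n`, stated
  on `uⁿ`), every element is `uⁱ` or `uⁱ·w` with `i < 2n`; exponent bookkeeping in `ℤ/2n` (`pow_val_add`, `inv_pow_val`, `pow_mul_w_mul_inv_pow`).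
Part II (`Census/IndexTwoCyclicArcPairs.lean`) builds the ARC PAIRS `A(a, b)`; part III (`Census/IndexTwoCyclicDescent.lean`) descends every type to
the arc pairs along seat b23 gen 38ʼs cyclic boundary descent run in both coordinates (gen 48ʼs part III, uniform in `r`); parts IV–V
(`Census/IndexTwoCyclicArcHodge.lean`, `Census/IndexTwoCyclicArcLattice.lean`): the arc faces are the unit squares of the torus `(ℤ/2n)²`, one per
arc block except the block of `A(0,0)` generates all of them (row telescoping), and a descent to the half cross `{A(a,0)} ∪ {A(0,b)}`, `a, b ≤ n`,
whose Hodge vectors are multiples of one pair, gives `μ(G, c) ≤ β − 1` for EVERY `r`; part VI (`Census/IndexTwoCyclicLaw.lean`): `= β − 1 = φ₂`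
whenever the odd coset elements `uⁱ·w`, `i` odd, carry `c` among their powers (modular and semidihedral columns).  The laws take
`(hc2 : c·c = 1) (hc1 : c ≠ 1)` in the house style.

## References
* [Pohlmann1968] H. Pohlmann, Algebraic cycles on abelian varieties of complex multiplication type, Ann. of Math. 88 (1968), Thm 1.
* [Milne1999] J. S. Milne, Lefschetz motives and the Tate conjecture, Compositio Math. 117 (1999), Prop. 2.1, p. 54.
-/

namespace Summit.HodgeConjecture.CorCM.Census.IndexTwoCyclic

open Finset
open Summit.HodgeConjecture.CorCM.Prior.AllgGroup.RfwfAllgGroup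
open Summit.HodgeConjecture.CorCM.Census.BlockParity

noncomputable section

variable {G : Type*} [Group G] [Fintype G] [DecidableEq G] {c : G} {n : ℕ} [NeZero n]

/-! ## §1 The datum -/

/-- **An index-two cyclic datum for `(G, c)` at level `n`**: a rotation `u` of order `2n` with `uⁿ = c` generating a subgroup of index two, and
an involution `w` outside it with `w·u = uʳ·w`.  Then `G ≅ ℤ/2n ⋊_r ℤ/2` (`r² ≡ 1 (mod 2n)`): `ℤ/2n × ℤ/2` (`r = 1`), the dihedral group
(`r = 2n − 1`), the modular group (`r = n + 1`), the semidihedral group (`r = n − 1`), … . [folklore] -/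
structure Datum (G : Type*) [Group G] (c : G) (n : ℕ) where
  /-- the generating rotation -/
  u : G
  /-- an involution outside the rotations -/
  w : G
  /-- the twisting exponent -/
  r : ℕ
  /-- `uⁿ = c` -/
  hun : u ^ n = c
  /-- `u` has order `2n` -/
  hord : orderOf u = 2 * n
  /-- the rotations form a subgroup of index two -/
  hindex : (Subgroup.zpowers u).index = 2
  /-- `w` is not a rotation -/
  hw : w ∉ Subgroup.zpowers u
  /-- `w` is an involution -/
  hww : w * w = 1
  /-- `w` conjugates `u` to `uʳ` -/
  htwist : w * u = u ^ r * w

variable (D : Datum G c n)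

namespace Datum

include D

omit [Fintype G] [DecidableEq G] [NeZero n] in
/-- `w⁻¹ = w`. [folklore] -/
theorem w_inv : D.w⁻¹ = D.w := inv_eq_of_mul_eq_one_right D.hww

omit [Fintype G] [DecidableEq G] [NeZero n] in
/-- A rotation times `w` is not a rotation. [folklore] -/
theorem mul_w_notMem {y : G} (hy : y ∈ Subgroup.zpowers D.u) : y * D.w ∉ Subgroup.zpowers D.u := fun h =>
  D.hw (by simpa only [inv_mul_cancel_left] using Subgroup.mul_mem _ (Subgroup.inv_mem _ hy) h)

omit [Fintype G] [DecidableEq G] [NeZero n] in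
/-- `uⁱ·w` is not a rotation. [folklore] -/
theorem pow_mul_w_notMem (i : ℕ) : D.u ^ i * D.w ∉ Subgroup.zpowers D.u :=
  D.mul_w_notMem (Subgroup.pow_mem _ (Subgroup.mem_zpowers _) i)

omit [Fintype G] [DecidableEq G] [NeZero n] in
/-- **The twisted relation on powers**: `w·uⁱ = u^{ri}·w`. [folklore] -/
theorem w_mul_pow (i : ℕ) : D.w * D.u ^ i = D.u ^ (D.r * i) * D.w := by
  induction i with
  | zero => rw [pow_zero, mul_zero, pow_zero, mul_one, one_mul]
  | succ i ih =>
    rw [pow_succ, ← mul_assoc, ih, mul_assoc, D.htwist, ← mul_assoc, ← pow_add, Nat.mul_succ]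

omit [Fintype G] [DecidableEq G] [NeZero n] in
/-- `w·uⁱ·w = u^{ri}`. [folklore] -/
theorem w_mul_pow_mul_w (i : ℕ) : D.w * D.u ^ i * D.w = D.u ^ (D.r * i) := by
  rw [D.w_mul_pow, mul_assoc, D.hww, mul_one]

omit [Fintype G] [DecidableEq G] [NeZero n] in
/-- `u^{2n} = 1`. [folklore] -/
theorem pow_two_mul : D.u ^ (2 * n) = 1 := by rw [← D.hord]; exact pow_orderOf_eq_one D.u

omit [Fintype G] [DecidableEq G] [NeZero n] in
/-- Powers of `u` are determined modulo `2n`: `uⁱ = uʲ ↔ i ≡ j (mod 2n)`. [folklore] -/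
theorem pow_eq_pow_iff (i j : ℕ) : D.u ^ i = D.u ^ j ↔ (i : ZMod (2 * n)) = (j : ZMod (2 * n)) := by
  rw [pow_eq_pow_iff_modEq, D.hord, ZMod.natCast_eq_natCast_iff]

omit [Fintype G] [DecidableEq G] [NeZero n] in
/-- **`r² ≡ 1 (mod 2n)`**: conjugating twice is the identity. [folklore] -/
theorem r_mul_r : ((D.r * D.r : ℕ) : ZMod (2 * n)) = 1 := by
  have h : D.u ^ (D.r * D.r) = D.u ^ 1 := by
    have h1 : D.w * D.u ^ D.r * D.w = D.u ^ (D.r * D.r) := D.w_mul_pow_mul_w D.r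
    have h2 : D.w * D.u * D.w = D.u ^ D.r := by simpa only [mul_one, pow_one] using D.w_mul_pow_mul_w 1
    -- `u = w (w u w) w = w uʳ w = u^{r r}`
    have h3 : D.w * (D.w * D.u * D.w) * D.w = D.u := by
      rw [show D.w * (D.w * D.u * D.w) * D.w = (D.w * D.w) * D.u * (D.w * D.w) by group, D.hww, one_mul, mul_one]
    rw [h2] at h3
    rw [← h1, h3, pow_one]
  have e := (D.pow_eq_pow_iff _ _).mp h
  rwa [Nat.cast_one] at e

omit [Fintype G] [DecidableEq G] [NeZero n] in
/-- **`r` is odd** (`r² ≡ 1` modulo the even number `2n`). [folklore] -/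
theorem odd_r : Odd D.r := by
  have e := D.r_mul_r
  rw [show (1 : ZMod (2 * n)) = ((1 : ℕ) : ZMod (2 * n)) by rw [Nat.cast_one], ZMod.natCast_eq_natCast_iff, Nat.ModEq] at e
  have h2 : (D.r * D.r) % 2 = 1 % (2 * n) % 2 := by
    have h := Nat.mod_mod_of_dvd (D.r * D.r) (dvd_mul_right 2 n)
    rw [e] at h
    rw [← h]
  rw [Nat.mod_mod_of_dvd 1 (dvd_mul_right 2 n)] at h2
  rcases Nat.even_or_odd D.r with hr | hr
  · exfalso
    have : (D.r * D.r) % 2 = 0 := Nat.even_iff.mp (hr.mul_right D.r)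
    omega
  · exact hr

omit [Fintype G] [DecidableEq G] [NeZero n] in
/-- **`u^{rn} = uⁿ`** (`r` odd): conjugation by `w` fixes `c`. [folklore] -/
theorem pow_r_mul_n : D.u ^ (D.r * n) = D.u ^ n := by
  obtain ⟨m, hm⟩ := D.odd_r
  have e : (2 * m + 1) * n = (2 * n) * m + n := by ring
  rw [hm, e, pow_add, pow_mul, D.pow_two_mul, one_pow, one_mul]

omit [Fintype G] [DecidableEq G] [NeZero n] in
/-- In `ℤ/2n`: `r·n = n`. [folklore] -/
theorem r_mul_n_cast : ((D.r : ZMod (2 * n)) * (n : ZMod (2 * n))) = (n : ZMod (2 * n)) := by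
  have h := (D.pow_eq_pow_iff _ _).mp D.pow_r_mul_n
  rwa [Nat.cast_mul] at h

omit [Fintype G] [DecidableEq G] [NeZero n] in
/-- `w·c = c·w`. [folklore] -/
theorem w_mul_c : D.w * c = c * D.w := by
  have h := D.w_mul_pow n
  rw [D.pow_r_mul_n, D.hun] at h
  exact h

omit [DecidableEq G] in
/-- **Every element is a rotation `uⁱ` or a coset element `uⁱ·w`**, `i < 2n`. [folklore] -/
theorem exists_pow_or_pow_mul_w (y : G) : ∃ i : ℕ, i < 2 * n ∧ (y = D.u ^ i ∨ y = D.u ^ i * D.w) := by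
  have hn : 1 ≤ n := Nat.one_le_iff_ne_zero.mpr (NeZero.ne n)
  have hfin : ∀ z : G, z ∈ Subgroup.zpowers D.u → ∃ i : ℕ, i < 2 * n ∧ D.u ^ i = z := by
    intro z hz
    have hz' : z ∈ Submonoid.powers D.u := ((isOfFinOrder_of_finite D.u).mem_powers_iff_mem_zpowers).mpr hz
    obtain ⟨k, rfl⟩ := Submonoid.mem_powers_iff _ _ |>.mp hz'
    refine ⟨k % (2 * n), Nat.mod_lt _ (by omega), ?_⟩
    rw [← D.hord, pow_mod_orderOf]
  by_cases hy : y ∈ Subgroup.zpowers D.u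
  · obtain ⟨i, hi, h⟩ := hfin y hy
    exact ⟨i, hi, Or.inl h.symm⟩
  · have hyx : y * D.w ∈ Subgroup.zpowers D.u := by
      rw [Subgroup.mul_mem_iff_of_index_two D.hindex]
      exact ⟨fun h => absurd h hy, fun h => absurd h D.hw⟩
    obtain ⟨i, hi, h⟩ := hfin (y * D.w) hyx
    refine ⟨i, hi, Or.inr ?_⟩
    calc y = y * D.w * D.w := by rw [mul_assoc, D.hww, mul_one]
      _ = D.u ^ i * D.w := by rw [h]

omit [DecidableEq G] in
/-- **`uⁿ = c` commutes with every element** (so `c` is central: `fun y => D.hun ▸ D.comm_pow_n y`). [folklore] -/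
theorem comm_pow_n (y : G) : y * D.u ^ n = D.u ^ n * y := by
  have huw : D.u ^ n * D.w = D.w * D.u ^ n := by
    have h := D.w_mul_pow n
    rw [D.pow_r_mul_n] at h
    exact h.symm
  obtain ⟨i, -, h | h⟩ := D.exists_pow_or_pow_mul_w y
  · rw [h, ← pow_add, ← pow_add, add_comm]
  · rw [h, mul_assoc, ← huw, ← mul_assoc, ← pow_add, add_comm, pow_add, mul_assoc]

omit [Fintype G] [DecidableEq G] [NeZero n] in
/-- A rotation is not a coset element. [folklore] -/
theorem pow_ne_pow_mul_w (i j : ℕ) : D.u ^ i ≠ D.u ^ j * D.w := fun h =>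
  D.pow_mul_w_notMem j (h ▸ Subgroup.pow_mem _ (Subgroup.mem_zpowers _) i)

omit [Fintype G] [DecidableEq G] [NeZero n] in
/-- Coset elements are determined by their exponent modulo `2n`. [folklore] -/
theorem pow_mul_w_eq_iff (i j : ℕ) : D.u ^ i * D.w = D.u ^ j * D.w ↔ (i : ZMod (2 * n)) = (j : ZMod (2 * n)) := by
  rw [← D.pow_eq_pow_iff]
  constructor
  · intro h; exact mul_right_cancel h
  · intro h; rw [h]

omit [Fintype G] [DecidableEq G] in
/-- The exponent of a `ℤ/2n`-value: `u^{(k : ℤ/2n).val} = uᵏ`. [folklore] -/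
theorem pow_val_natCast (k : ℕ) : D.u ^ ((k : ZMod (2 * n))).val = D.u ^ k := by
  rw [D.pow_eq_pow_iff, ZMod.natCast_zmod_val]

omit [Fintype G] [DecidableEq G] in
/-- The exponent of a sum: `u^{(a+b).val} = u^{a.val} · u^{b.val}`. [folklore] -/
theorem pow_val_add (a b : ZMod (2 * n)) : D.u ^ (a + b).val = D.u ^ a.val * D.u ^ b.val := by
  rw [← pow_add, D.pow_eq_pow_iff]; push_cast; simp only [ZMod.natCast_zmod_val]

omit [Fintype G] [DecidableEq G] in
/-- **The inverse of `u^{z.val}` is `u^{(−z).val}`.** [folklore] -/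
theorem inv_pow_val (z : ZMod (2 * n)) : (D.u ^ z.val)⁻¹ = D.u ^ (-z).val := by
  apply inv_eq_of_mul_eq_one_right
  rw [← D.pow_val_add, add_neg_cancel, ZMod.val_zero, pow_zero]

omit [Fintype G] [DecidableEq G] in
/-- `w · u^{z.val} = u^{(r z).val} · w` in `ℤ/2n`-exponents. [folklore] -/
theorem w_mul_pow_val (z : ZMod (2 * n)) : D.w * D.u ^ z.val = D.u ^ ((D.r : ZMod (2 * n)) * z).val * D.w := by
  rw [D.w_mul_pow]
  congr 1
  rw [D.pow_eq_pow_iff, ZMod.natCast_zmod_val, Nat.cast_mul, ZMod.natCast_zmod_val]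

omit [Fintype G] [DecidableEq G] in
/-- `u^{z.val} · w · (u^{k.val})⁻¹ = u^{(z − r k).val} · w`: moving a rotation past `w` twists it by `r`. [folklore] -/
theorem pow_mul_w_mul_inv_pow (z k : ZMod (2 * n)) :
    D.u ^ z.val * D.w * (D.u ^ k.val)⁻¹ = D.u ^ (z - (D.r : ZMod (2 * n)) * k).val * D.w := by
  rw [D.inv_pow_val, mul_assoc, D.w_mul_pow_val, ← mul_assoc, ← D.pow_val_add, mul_neg, ← sub_eq_add_neg]

end Datum

end

end Summit.HodgeConjecture.CorCM.Census.IndexTwoCyclic
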